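import Summits.HodgeConjecture.HodgeConjecture.Theorems.Ring2AtlasSixfolds
import Summits.HodgeConjecture.HodgeConjecture.Theorems.Ring2WeilTypeHodgeRing
import Summits.HodgeConjecture.HodgeConjecture.Theorems.Ring2HypothesesCMPowerAnchors
import Summits.HodgeConjecture.HodgeConjecture.Theorems.Ring2HypothesesGeneralFibre
import Literature.AlgebraicGeometry.Deligne1982.WeilTypeCMHodgeRing
import Literature.AlgebraicGeometry.Motives.AbelianVarietyProductDimProofs
import HarnessLib

/-!
# Ring 2, hypotheses layer XIV — the atlas-2 cells (`g = 6, 7`) served BY NAME from the typed hypotheses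

HONEST FRAMING: research route conditional on HC_CM; not a corollary; Q11.4-sentence-2 already refuted in
dim ≥ 3. `HC_CM` = `Theses.RankFourFaces.CMAbelianHodge` is an ARGUMENT of every row that uses it, never a fact.

Atlas-2 (`Theorems/Ring2AtlasSixfolds.lean`, namespace `Ring2.Atlas`) typed the six open cells of the Hodge
conjecture for complex abelian varieties of dimension `6` and `7` as named `Prop`s in typer 1's frame
`HCOnClass 𝒞` — each cell concludes the FULL Hodge conjecture `HodgeConjectureFor A.dim A.X` for its members.
This file is the hypotheses-layer service promised in RING2-MAP §hypotheses (addendum A): every cell is derived,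
by name and without restating it, from the typed inputs of parts V–VIII, and each row records the KIND of
`HC_CM` it carries.

* **Weil cells** `HodgeSexticFieldWeilSixfold` (III(2), `F ⊃ k` sextic CM), `HodgeQuaternionSixfold` (III(1)),
  `HodgeUnitaryThreefoldPair` (VI(1,1)) and the `N = 0` member `E × Y` of
  `HodgePowersOfCMEllipticTimesUnitaryFivefold`: two inputs, both typed —
  (W) **the Weil classes of sixfolds are algebraic**, i.e. the route item `Theses.SevenfoldWeilCensus.WeilSixfolds`
  (stmt `W₆`; here supplied from part VII's components through van Geemen's Lemma 5.2
  `PolarizedWeilDiscriminantExists`: `weilSixfolds_of_components`, HC_CM-FREE via W1′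
  `weilSixfolds_of_divisorGeneratedCMPointed`, NOMINAL via W1 `weilSixfolds_of_HC_CM`), and
  (G) **generation** `B•(A) = D•(A) + Σ_k W_k` — the Moonen–Zarhin / Murty computation that the Hodge ring of a
  member is generated by divisor classes and the Weil classes of ALL its Weil structures `k ⊂ End⁰(A)`.
  (G) is CELL INFERENCE in atlas-2's docstrings, not a tree theorem: it enters as the typed predicate
  `IsDivisorMultiWeilGenerated A` (§2; for ONE Weil structure it is typer 1's Literature predicate
  `IsDivisorWeilGenerated A φ n d`, van Geemen Thm. 6.12), never asserted. Engine:
  `hodgeConjectureFor_of_isDivisorMultiWeilGenerated` (Lefschetz `(1,1)` on `D•`, (W) on each `W_k`).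
* **VHC cells** `HodgeQuarticTypeIVFourfoldTimesCMSurface` (K3 partner `T(c₇) × (CM surface)`) and the power
  cells `HodgePowersOfCMEllipticTimesUnitaryFivefold` / `…Sixfold`: the members are NOT of Weil type as wholes
  (`(E × Y)ᴺ⁺¹`, `N ≥ 1`) or carry exceptional classes of unknown shape; the hypotheses layer serves them through
  part V's anchored invariant-cycles engine — `hcOnClass_of_anchoredICFamilies_through` (ANY anchor: a
  CM-elliptic-power fibre by Tate, a divisor-generated fibre by Lefschetz, a fibre of dimension `≤ 3` — `HC_CM`
  DISCHARGED there) and `hcOnClass_of_HC_CM_of_invariantCycles_through` (Abdulali's Lemma 6.2 with Deligne's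
  CM-anchored Hodge families: `HC_CM` LOAD-BEARING, Grothendieck's (1.1) on the families the open input).

Nothing here asserts (W), (G), (1.1) or `HC_CM`; §6 records that the Weil input (W) holds under the full
Hodge conjecture (on path). What is NOT served: the deformation axis of the same cells (route `deform`,
`Theorems/Ring2DeformAtlasSixfolds.lean`: `CMSpreadingAt`, free CM fibres) — not restated here.

References: B. van Geemen, *An introduction to the Hodge conjecture for abelian varieties*, LNM 1594 (1994),
4.9–4.11, Lemma 5.2, Thm. 6.12 [vanGeemen1994HodgeAV]; B. Moonen, Yu. Zarhin, *Hodge classes on abelian varieties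
of low dimension*, Math. Ann. 315 (1999), (1.8), §4–§5 [MoonenZarhin1999LowDim]; P. Deligne (notes by J. Milne),
*Hodge cycles on abelian varieties*, LNM 900 (1982), §4 Prop. 4.4, Thm. 4.8, §5 [Deligne1982HodgeCycles];
S. Abdulali, *Algebraic cycles in families of abelian varieties*, Canad. J. Math. 46 (1994), (1.1), Lemma 6.2
[Abdulali1994FamiliesAV]; E. Markman, arXiv:2502.03415, Thm. 1.5.1 [Markman2025SecantWeil]; P. Deligne, *The Hodge
conjecture* (Clay, 2000), §1 [Deligne2000].
-/

set_option linter.dupNamespace false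

noncomputable section

open CategoryTheory
open Literature.AlgebraicGeometry Literature.AlgebraicGeometry.Motives
open Literature.AlgebraicGeometry.HodgeTheory
open Literature.AlgebraicTopology.SingularHomology
open Literature.AlgebraicGeometry.Milne1999 (IsOfCMType)
open Literature.AlgebraicGeometry.VanGeemen1994
open Literature.AlgebraicGeometry.Abdulali1994 (InvariantCyclesHoldFor IsCMAnchoredHodgeFamilyFor
  deligne1982_exists_cmAnchoredHodgeFamily)
open Literature.Barriers.HodgeConjecture (divisorClassesSpan)
open Summit.HodgeConjecture.HodgeConjecture.WeilTypeLadder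
open Summit.HodgeConjecture.HodgeConjecture.Theses
open Summit.HodgeConjecture.HodgeConjecture.Ring2.ClassTargets
open Summit.HodgeConjecture.HodgeConjecture.Ring2.Atlas
open Summit.HodgeConjecture.HodgeConjecture.Theorems.HodgeAbelianVarieties.Unconditional
  (divisorClassesSpan_le_algebraicClasses_holds)

namespace Summit.HodgeConjecture.HodgeConjecture.Ring2.Hypotheses

/-! ## §1 Atlas-2's eigenvalue binders versus the Literature predicate `IsWeilType` -/

/-- **Bridge: atlas-2's Weil-type binders give `IsWeilType`.** Atlas-2 records a Weil structure by
`φ ≫ φ = -d`, `dim A = 2n` and van Geemen's multiplicity condition `eigenMultiplicity A φ (i√d) = n` (4.9, on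
`H^{1,0}` for the `A.dim`-indexed Hodge structure); the Literature predicate `IsWeilType A φ n d` records the same
multiplicity for the `2n`-indexed one — the two `H^{1,0}` agree (`Deligne1982.hodgeOneZero_eq_of_dim_eq`).
[cite: vanGeemen1994HodgeAV, 4.9–4.10] [cite: Deligne1982HodgeCycles, §4 Prop. 4.4] -/
theorem isWeilType_of_eigenMultiplicity_eq {A : AbelianVariety ℂ} {φ : A ⟶ A} {n d : ℕ} (hn : 0 < n)
    (hd : 0 < d) (hA : A.dim = 2 * n) (hφ : φ ≫ φ = -(d • 𝟙 A))
    (hm : eigenMultiplicity A φ (Complex.I * (Real.sqrt d : ℂ)) = n) : IsWeilType A φ n d := by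
  refine ⟨hn, hd, hA, hφ, ?_⟩
  rw [Deligne1982.hodgeOneZero_eq_of_dim_eq hA (isSmoothProjective_of_dim_eq' hA)
    (AbelianVariety.isSmoothProjective_holds (A := A))]
  exact hm

/-- Converse bookkeeping: a Weil-type `(A, φ)` of type `(n, d)` satisfies atlas-2's eigenvalue binder
`eigenMultiplicity A φ (i√d) = n`. [cite: vanGeemen1994HodgeAV, 4.9–4.10] -/
theorem eigenMultiplicity_eq_of_isWeilType {A : AbelianVariety ℂ} {φ : A ⟶ A} {n d : ℕ}
    (h : IsWeilType A φ n d) : eigenMultiplicity A φ (Complex.I * (Real.sqrt d : ℂ)) = n := by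
  have key : eigenMultiplicity A φ (Complex.I * (Real.sqrt d : ℂ)) =
      Module.finrank ℂ ↥(Module.End.eigenspace (complexBetti.map φ.hom.hom.hom 1).hom
        (Complex.I * (Real.sqrt d : ℂ)) ⊓ hodgeOneZero (AbelianVariety.isSmoothProjective_holds (A := A))) := rfl
  rw [key, ← Deligne1982.hodgeOneZero_eq_of_dim_eq h.dim_eq (isSmoothProjective_of_dim_eq' h.dim_eq)
    (AbelianVariety.isSmoothProjective_holds (A := A))]
  exact h.multiplicity_eq

/-! ## §2 Generation by divisors and ALL Weil classes (typed predicate, never asserted) and its engine -/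

/-- **All Weil classes of `A` in degree `2p`**: the sum `Σ_k W_k ⊗ ℂ` of the Weil planes
`weilClassesOf A φ p d` over ALL Weil structures `(φ, d)` of `A` of type `(p, d)` (an abelian variety may be
of Weil type for many `k = ℚ(φ) ⊂ End⁰(A)`: van Geemen 4.13, Moonen–Zarhin §4–§5; empty sum `= ⊥` unless
`dim A = 2p`). A DEFINITION. [cite: vanGeemen1994HodgeAV, 4.9 and 4.13] [cite: MoonenZarhin1999LowDim, §4] -/
def allWeilClasses (A : AbelianVariety ℂ) (p : ℕ) : Submodule ℂ (complexBetti A.X (2 * p)) :=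
  ⨆ w : {w : (A ⟶ A) × ℕ // IsWeilType A w.1 p w.2}, weilClassesOf A w.1.1 p w.1.2

/-- **`IsDivisorMultiWeilGenerated A` — "`B•(A) ⊗ ℂ ⊆ D•(A) ⊗ ℂ + Σ_k W_k ⊗ ℂ`"** (typed predicate): every
rational `(p,p)` class of `A` lies in the span of `p`-fold products of divisor classes plus the Weil classes of
all Weil structures of `A`. This is the generation statement the atlas-2 docstrings infer for their members
from Moonen–Zarhin 1999 (e.g. (1.8): `B• = D•` off the listed types; §5: the exceptional classes of the listed
sixfolds are Weil classes `W_k`) — CELL INFERENCE, entered here as a HYPOTHESIS on the member, never asserted.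
For one Weil structure it is implied by typer 1's `IsDivisorWeilGenerated A φ n d` (van Geemen Thm. 6.12).
[cite: MoonenZarhin1999LowDim, (1.8) and §5] [cite: vanGeemen1994HodgeAV, Thm. 6.12] -/
def IsDivisorMultiWeilGenerated (A : AbelianVariety ℂ) : Prop :=
  ∀ (p : ℕ) (c : complexBetti A.X (2 * p)), IsRationalClass c → IsOfHodgeType A.dim A.X (2 * p) p p c →
    c ∈ divisorClassesSpan A.X A.dim p ⊔ allWeilClasses A p

/-- Each Weil plane lies in the sum of all of them. [folklore] -/
theorem weilClassesOf_le_allWeilClasses {A : AbelianVariety ℂ} {φ : A ⟶ A} {p d : ℕ}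
    (h : IsWeilType A φ p d) : weilClassesOf A φ p d ≤ allWeilClasses A p :=
  le_iSup_of_le (f := fun w : {w : (A ⟶ A) × ℕ // IsWeilType A w.1 p w.2} ↦ weilClassesOf A w.1.1 p w.1.2)
    ⟨(φ, d), h⟩ le_rfl

/-- **One Weil structure**: typer 1's `IsDivisorWeilGenerated A φ n d` (`B• = D•` off degree `2n`,
`Bⁿ ⊆ Dⁿ + W_K`) implies `IsDivisorMultiWeilGenerated A`. [cite: vanGeemen1994HodgeAV, Thm. 6.12] -/
theorem isDivisorMultiWeilGenerated_of_isDivisorWeilGenerated {A : AbelianVariety ℂ} {φ : A ⟶ A} {n d : ℕ}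
    (h : IsWeilType A φ n d) (hDW : IsDivisorWeilGenerated A φ n d) : IsDivisorMultiWeilGenerated A := by
  intro p c hc hH
  by_cases hp : p = n
  · subst hp
    exact sup_le_sup_left (weilClassesOf_le_allWeilClasses h) _ (hDW.2 c hc hH)
  · exact Submodule.mem_sup_left (hDW.1 p c hp hc hH)

/-- If the Weil classes of every Weil structure of `A` of type `(p, ·)` are algebraic, so is their sum
(`IsWeilType.weilClassesOf_le_algebraicClasses` summed). [cite: Deligne1982HodgeCycles, §4 Prop. 4.4] -/
theorem allWeilClasses_le_algebraicClasses {A : AbelianVariety ℂ} {p : ℕ}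
    (hW : ∀ (d : ℕ) (φ : A ⟶ A), IsWeilType A φ p d → ∀ c ∈ weilClassesOf A φ p d, IsRationalClass c →
      IsOfHodgeType (2 * p) A.X (2 * p) p p c → c ∈ algebraicClasses A.X p) :
    allWeilClasses A p ≤ algebraicClasses A.X p :=
  iSup_le fun w ↦ w.2.weilClassesOf_le_algebraicClasses (hW w.1.2 w.1.1 w.2)

/-- **ENGINE — `HC(A)` from generation by divisors and Weil classes, given that the Weil classes of every Weil
structure of `A` are algebraic**: `D• ⊗ ℂ ⊆ N•` unconditionally (Lefschetz `(1,1)` and products, tree theorem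
`divisorClassesSpan_le_algebraicClasses_holds`), `Σ_k W_k ⊆ N•` by hypothesis. The per-member form of every
Weil-cell row below. [cite: vanGeemen1994HodgeAV, Thm. 6.12 and 2.4] [cite: Deligne2000, §1] -/
theorem hodgeConjectureFor_of_isDivisorMultiWeilGenerated {A : AbelianVariety ℂ}
    (hgen : IsDivisorMultiWeilGenerated A)
    (hW : ∀ (p d : ℕ) (φ : A ⟶ A), IsWeilType A φ p d → ∀ c ∈ weilClassesOf A φ p d, IsRationalClass c →
      IsOfHodgeType (2 * p) A.X (2 * p) p p c → c ∈ algebraicClasses A.X p) :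
    HodgeConjectureFor A.dim A.X := by
  refine ⟨nonempty_hodgeModel_holds (AbelianVariety.isSmoothProjective_holds (A := A)), fun p c hc hH ↦ ?_⟩
  exact sup_le (divisorClassesSpan_le_algebraicClasses_holds A p) (allWeilClasses_le_algebraicClasses (hW p))
    (hgen p c hc hH)

/-- **Supply of the Weil input from rung `R∞`** (`WeilClassesImaginaryQuadratic`, any dimension): for `p ≥ 2`
it is `R∞` at `(p, d)`; for `p = 1` the member is a surface and HC is unconditional (dimension `≤ 3`).
[cite: Deligne1982HodgeCycles, §4 Prop. 4.4 and Thm. 4.8] [cite: Deligne2000, §1] -/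
theorem weilClasses_algebraic_of_weilClassesImaginaryQuadratic (hR : WeilClassesImaginaryQuadratic)
    (A : AbelianVariety ℂ) :
    ∀ (p d : ℕ) (φ : A ⟶ A), IsWeilType A φ p d → ∀ c ∈ weilClassesOf A φ p d, IsRationalClass c →
      IsOfHodgeType (2 * p) A.X (2 * p) p p c → c ∈ algebraicClasses A.X p := by
  intro p d φ hW c hcW hc hH
  by_cases hp : 2 ≤ p
  · exact hR p hp d hW.d_pos A φ hW.dim_eq hW.isSmoothProjective hW.sq_eq c hc hH hcW
  · have h3 : A.dim ≤ 3 := by have := hW.dim_eq; omega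
    exact weilClasses_algebraic_of_hodgeConjectureFor hW
      (hodgeConjectureFor_of_dim_le_three_holds h3 (AbelianVariety.isSmoothProjective_holds (A := A))) c hcW hc hH

/-- **Supply of the Weil input for SIXFOLDS from the route item `W₆ = Theses.SevenfoldWeilCensus.WeilSixfolds`**
(through the on-path unfolding `WeilTypeLadder.weilSixfolds_iff_weilClassesOf`): on a sixfold a Weil structure
has `p = 3`. [cite: Deligne1982HodgeCycles, §4 Prop. 4.4] [cite: Markman2025SecantWeil, Thm. 1.5.1] -/
theorem weilClasses_algebraic_of_weilSixfolds (hW₆ : SevenfoldWeilCensus.WeilSixfolds) (A : AbelianVariety ℂ)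
    (hA : A.dim = 6) :
    ∀ (p d : ℕ) (φ : A ⟶ A), IsWeilType A φ p d → ∀ c ∈ weilClassesOf A φ p d, IsRationalClass c →
      IsOfHodgeType (2 * p) A.X (2 * p) p p c → c ∈ algebraicClasses A.X p := by
  intro p d φ hW c hcW hc hH
  obtain rfl : p = 3 := by have := hW.dim_eq; omega
  exact weilSixfolds_iff_weilClassesOf.1 hW₆ d hW.d_pos A φ hW.dim_eq hW.isSmoothProjective hW.sq_eq c hc hH
    hcW

/-- **Per-member Weil row for sixfolds**: `HC(A)` for a sixfold `A` with `B• ⊆ D• + Σ_k W_k`, given `W₆`.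
[cite: MoonenZarhin1999LowDim, §5] [cite: vanGeemen1994HodgeAV, Thm. 6.12] -/
theorem hodgeConjectureFor_of_multiWeilGenerated_of_weilSixfolds {A : AbelianVariety ℂ} (hA : A.dim = 6)
    (hgen : IsDivisorMultiWeilGenerated A) (hW₆ : SevenfoldWeilCensus.WeilSixfolds) :
    HodgeConjectureFor A.dim A.X :=
  hodgeConjectureFor_of_isDivisorMultiWeilGenerated hgen (weilClasses_algebraic_of_weilSixfolds hW₆ A hA)

/-! ## §3 `W₆` from the hypotheses layer (part VII's components + van Geemen's Lemma 5.2) -/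

/-- **`W₆` from the per-discriminant components**: if every component `(3, d, δ)` of the Weil moduli has
algebraic Weil classes (`WeilClassesComponent 3 d δ`, part VII-A) and every polarized Weil sixfold carrying a
non-zero Hodge Weil class sits on some component (van Geemen's Lemma 5.2, typed as
`PolarizedWeilDiscriminantExists`, part VII-B), then `WeilSixfolds`. [cite: vanGeemen1994HodgeAV, Lemma 5.2
and Thm. 4.11] [cite: Deligne1982HodgeCycles, §4 Thm. 4.8] -/
theorem weilSixfolds_of_components (hE : PolarizedWeilDiscriminantExists)
    (hC : ∀ d : ℕ, 0 < d → ∀ δ, WeilClassesComponent 3 d δ) : SevenfoldWeilCensus.WeilSixfolds := by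
  refine weilSixfolds_iff_weilClassesOf.2 fun d hd A φ hA hX hφ c hc hH hcW ↦ ?_
  by_cases hc0 : c = 0
  · rw [hc0]; exact Submodule.zero_mem _
  obtain ⟨e, a, δ, haQ, ha0, hδ⟩ := hE 3 d (by norm_num) hd A φ hA hX hφ ⟨c, hcW, hc, hH, hc0⟩
  exact hC d hd δ A φ hA hX hφ e a haQ ha0 hδ c hc hH hcW

/-- **`W₆`, `HC_CM`-FREE (row W1′ per component)**: CM-pointed Weil families of sixfolds whose CM point is
DIVISOR-GENERATED (`B• = D•` there: anchor by Lefschetz `(1,1)`, no `HC_CM`) plus the variational Hodge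
conjecture on each component give `WeilSixfolds`. [cite: vanGeemen1994HodgeAV, Thm. 4.3 and Lemma 5.2]
[cite: Abdulali1994FamiliesAV, (1.1) and Lemma 6.2] -/
theorem weilSixfolds_of_divisorGeneratedCMPointed (hE : PolarizedWeilDiscriminantExists)
    (hP : ∀ d : ℕ, 0 < d → ∀ δ, DivisorGeneratedCMPointedWeilFamiliesComponent 3 d δ)
    (hV : ∀ d : ℕ, 0 < d → ∀ δ, WeilVariationalHodgeComponent 3 d δ) : SevenfoldWeilCensus.WeilSixfolds :=
  weilSixfolds_of_components hE fun d hd δ ↦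
    weilClassesComponent_of_divisorGeneratedCMPointed (hP d hd δ) (hV d hd δ)

/-- **`W₆`, `HC_CM` NOMINAL (row W1 per component)**: CM-pointed Weil families of sixfolds (any CM point, an
anchor under `HC_CM`) plus the variational Hodge conjecture on each component give `WeilSixfolds`; `HC_CM` is an
ARGUMENT. [cite: Deligne1982HodgeCycles, §5 (CM points on Weil families)] [cite: Abdulali1994FamiliesAV, Lemma 6.2] -/
theorem weilSixfolds_of_HC_CM (hCM : RankFourFaces.CMAbelianHodge) (hE : PolarizedWeilDiscriminantExists)
    (hP : ∀ d : ℕ, 0 < d → ∀ δ, CMPointedWeilFamiliesComponent 3 d δ)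
    (hV : ∀ d : ℕ, 0 < d → ∀ δ, WeilVariationalHodgeComponent 3 d δ) : SevenfoldWeilCensus.WeilSixfolds :=
  weilSixfolds_of_components hE fun d hd δ ↦ weilClassesComponent_of_HC_CM hCM (hP d hd δ) (hV d hd δ)

/-- **`W₆`, `HC_CM` DISCHARGED by Tate (row W1‴ per component, part VIII)**: Weil families of sixfolds through a
CM-ELLIPTIC-POWER point `E⁶` plus the variational Hodge conjecture on each component give `WeilSixfolds`.
[cite: vanGeemen1994HodgeAV, Thm. 4.3 and 5.7–5.11] [cite: Schoen1988HodgeWeil, §6] -/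
theorem weilSixfolds_of_cmPowerPointed (hE : PolarizedWeilDiscriminantExists)
    (hP : ∀ d : ℕ, 0 < d → ∀ δ, CMPowerPointedWeilFamiliesComponent 3 d δ)
    (hV : ∀ d : ℕ, 0 < d → ∀ δ, WeilVariationalHodgeComponent 3 d δ) : SevenfoldWeilCensus.WeilSixfolds :=
  weilSixfolds_of_components hE fun d hd δ ↦ weilClassesComponent_of_cmPowerPointed (hP d hd δ) (hV d hd δ)

/-! ## §4 The Weil cells from (W) `W₆` and (G) generation — `HC_CM` not an input -/

/-- **Generic Weil row**: a class of SIXFOLDS each generated by divisors and Weil classes satisfies its cell,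
given `W₆`. [cite: MoonenZarhin1999LowDim, §5] [cite: vanGeemen1994HodgeAV, Thm. 6.12] -/
theorem hcOnClass_of_multiWeilGenerated_of_weilSixfolds {𝒞 : AbelianVariety ℂ → Prop}
    (h6 : ∀ A, 𝒞 A → A.dim = 6) (hgen : ∀ A, 𝒞 A → IsDivisorMultiWeilGenerated A)
    (hW₆ : SevenfoldWeilCensus.WeilSixfolds) : HCOnClass 𝒞 :=
  fun A hA ↦ hodgeConjectureFor_of_multiWeilGenerated_of_weilSixfolds (h6 A hA) (hgen A hA) hW₆

/-- **Generic Weil row, any dimension, from `R∞`** (`WeilClassesImaginaryQuadratic`).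
[cite: Deligne1982HodgeCycles, §4 Thm. 4.8] [cite: vanGeemen1994HodgeAV, Thm. 6.12] -/
theorem hcOnClass_of_multiWeilGenerated_of_weilClassesImaginaryQuadratic {𝒞 : AbelianVariety ℂ → Prop}
    (hgen : ∀ A, 𝒞 A → IsDivisorMultiWeilGenerated A) (hR : WeilClassesImaginaryQuadratic) : HCOnClass 𝒞 :=
  fun A hA ↦ hodgeConjectureFor_of_isDivisorMultiWeilGenerated (hgen A hA)
    (weilClasses_algebraic_of_weilClassesImaginaryQuadratic hR A)

/-- **Cell III(2) `HodgeSexticFieldWeilSixfold` ⟸ (G) van Geemen's `B• = D• + W_k` for the member's OWN Weil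
structure `k ⊂ F` (typer 1's `IsDivisorWeilGenerated A φ 3 d`, a hypothesis on members) + (W) `W₆`.**
[cite: MoonenZarhin1999LowDim, §5] [cite: vanGeemen1994HodgeAV, Thm. 4.11 and Thm. 6.12] -/
theorem hodgeSexticFieldWeilSixfold_of_isDivisorWeilGenerated_of_weilSixfolds
    (hgen : ∀ (A : AbelianVariety ℂ) (φ : A ⟶ A) (d : ℕ), 0 < d → A.dim = 6 → A.IsSimple →
      IsField A.endAlgebra → Module.finrank ℚ A.endAlgebra = 6 → φ ≫ φ = -(d • 𝟙 A) →
      eigenMultiplicity A φ (Complex.I * (Real.sqrt d : ℂ)) = 3 → IsDivisorWeilGenerated A φ 3 d)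
    (hW₆ : SevenfoldWeilCensus.WeilSixfolds) : HodgeSexticFieldWeilSixfold := by
  intro A φ d hd hA hs hF hrk hφ hm
  have hWT : IsWeilType A φ 3 d := isWeilType_of_eigenMultiplicity_eq (by norm_num) hd hA hφ hm
  exact hodgeConjectureFor_of_multiWeilGenerated_of_weilSixfolds hA
    (isDivisorMultiWeilGenerated_of_isDivisorWeilGenerated hWT (hgen A φ d hd hA hs hF hrk hφ hm)) hW₆

/-- **Cell III(1) `HodgeQuaternionSixfold` ⟸ (G) `B• ⊆ D• + Σ_k W_k` over the imaginary quadratic `k ⊂ D`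
(Moonen–Zarhin §5; type II members have `B• = D•`, (1.8)) + (W) `W₆`.** [cite: MoonenZarhin1999LowDim, (1.8),
Thm. 0.2 and §5] [cite: Murty1984, Thm. (type III)] -/
theorem hodgeQuaternionSixfold_of_multiWeilGenerated_of_weilSixfolds
    (hgen : ∀ A : AbelianVariety ℂ, A.dim = 6 ∧ A.IsSimple ∧ (∃ ψ χ : A ⟶ A, ψ ≫ χ ≠ χ ≫ ψ) ∧
      HasNoTypeIVFactor A → IsDivisorMultiWeilGenerated A)
    (hW₆ : SevenfoldWeilCensus.WeilSixfolds) : HodgeQuaternionSixfold :=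
  hcOnClass_of_multiWeilGenerated_of_weilSixfolds (fun _ h ↦ h.1) hgen hW₆

/-- **Cell VI(1,1) `HodgeUnitaryThreefoldPair` ⟸ (G) `B•(Y × Y') ⊆ D• + Σ W` (Moonen–Zarhin §4: the
exceptional classes of `Y × Y'` are Weil classes for `k` acting diagonally, in degree 6) + (W) `W₆`**
(`dim (Y × Y') = 6` by `AbelianVariety.dim_prod`). [cite: MoonenZarhin1999LowDim, §4 and §5 Case 2] -/
theorem hodgeUnitaryThreefoldPair_of_multiWeilGenerated_of_weilSixfolds
    (hgen : ∀ (Y Y' : AbelianVariety ℂ) (ψ : Y ⟶ Y) (ψ' : Y' ⟶ Y') (d : ℕ), 0 < d → Y.dim = 3 → Y'.dim = 3 →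
      Y.IsSimple → Y'.IsSimple → ¬ AbelianVariety.IsIsogenous Y Y' → ψ ≫ ψ = -(d • 𝟙 Y) →
      ψ' ≫ ψ' = -(d • 𝟙 Y') → IsDivisorMultiWeilGenerated (Y.prod Y'))
    (hW₆ : SevenfoldWeilCensus.WeilSixfolds) : HodgeUnitaryThreefoldPair := by
  intro Y Y' ψ ψ' d hd hY hY' hs hs' hni hψ hψ'
  have h6 : (Y.prod Y').dim = 6 := by rw [AbelianVariety.dim_prod, hY, hY']
  exact hodgeConjectureFor_of_multiWeilGenerated_of_weilSixfolds h6
    (hgen Y Y' ψ ψ' d hd hY hY' hs hs' hni hψ hψ') hW₆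

/-- **The `N = 0` member `E × Y` of `HodgePowersOfCMEllipticTimesUnitaryFivefold`** (a sixfold of Weil type
for `k` acting diagonally, Moonen–Zarhin (3.8)) ⟸ (G) + (W) `W₆`; the powers `N ≥ 1` are not of Weil type as
wholes and go through §5. [cite: MoonenZarhin1999LowDim, §3 (3.8) and §5 Case 2] -/
theorem hodgeConjectureFor_prod_of_multiWeilGenerated_of_weilSixfolds {E Y : AbelianVariety ℂ} (hE : E.dim = 1)
    (hY : Y.dim = 5) (hgen : IsDivisorMultiWeilGenerated (E.prod Y)) (hW₆ : SevenfoldWeilCensus.WeilSixfolds) :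
    HodgeConjectureFor ((E.prod Y).powSucc 0).dim ((E.prod Y).powSucc 0).X :=
  hodgeConjectureFor_of_multiWeilGenerated_of_weilSixfolds (by rw [AbelianVariety.powSucc_zero,
    AbelianVariety.dim_prod, hE, hY]) hgen hW₆

/-! ## §5 The VHC cells through part V's anchored invariant-cycles engine -/

/-- **Generic VHC row, `HC_CM`-FREE — any anchor**: a class `𝒞` satisfies its cell if every rational `(p,p)`
class of every member rides a fibrewise-Hodge global class on a smooth projective family through the member
that satisfies Grothendieck's (1.1) and has SOME anchor fibre (`anchorLocus`: a CM-elliptic power by Tate —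
`cmPowerLocus_subset_anchorLocus`; a divisor-generated fibre — `mem_anchorLocus_of_divisorGeneratedChart`; a
fibre of dimension `≤ 3`; or a CM fibre under `HC_CM` — `cmLocus_subset_anchorLocus_of_HC_CM`).
[cite: Abdulali1994FamiliesAV, (1.1) and proof of Lemma 6.2 (p. 1131)] [cite: vanGeemen1994HodgeAV, Thm. 4.3] -/
theorem hcOnClass_of_anchoredICFamilies_through {𝒞 : AbelianVariety ℂ → Prop}
    (hfam : ∀ A, 𝒞 A → ∀ (p : ℕ) (c : complexBetti A.X (2 * p)), IsRationalClass c →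
      IsOfHodgeType A.dim A.X (2 * p) p p c →
        ∃ (𝒳 S : SchemeOver ℂ) (f : 𝒳 ⟶ S) (s₁ : ComplexPoints S) (e : A.X ≅ fiberOver f s₁)
          (W : complexBetti 𝒳 (2 * p)),
          (∀ t : ComplexPoints S, IsRationalClass (complexBetti.map (fiberι f t) (2 * p) W) ∧
            IsOfHodgeType A.dim (fiberOver f t) (2 * p) p p (complexBetti.map (fiberι f t) (2 * p) W)) ∧
          complexBetti.map e.hom (2 * p) (complexBetti.map (fiberι f s₁) (2 * p) W) = c ∧
          InvariantCyclesHoldFor f A.dim ∧ (anchorLocus f A.dim).Nonempty) :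
    HCOnClass 𝒞 :=
  fun A hA ↦ hodgeConjectureFor_of_anchoredICFamilies_through (AbelianVariety.isSmoothProjective_holds (A := A))
    (hfam A hA)

/-- **Generic VHC row, `HC_CM` LOAD-BEARING** (part VI's D3 with Deligne's printed supply of CM-anchored Hodge
families `deligne1982_exists_cmAnchoredHodgeFamily`): `HC_CM` + (1.1) on every CM-anchored Hodge family through
a member ⟹ the cell. `HC_CM` is an ARGUMENT. [cite: Abdulali1994FamiliesAV, Lemma 6.2 (p. 1131)]
[cite: Deligne1982HodgeCycles, §5 and §6 Prop. 6.1] -/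
theorem hcOnClass_of_HC_CM_of_invariantCycles_through (hCM : RankFourFaces.CMAbelianHodge)
    (hex : deligne1982_exists_cmAnchoredHodgeFamily) {𝒞 : AbelianVariety ℂ → Prop}
    (hIC : ∀ A, 𝒞 A → ∀ (p : ℕ) (c : complexBetti A.X (2 * p)) ⦃𝒳 S : SchemeOver ℂ⦄ (f : 𝒳 ⟶ S),
      IsCMAnchoredHodgeFamilyFor A p c f → InvariantCyclesHoldFor f A.dim) : HCOnClass 𝒞 :=
  fun A hA ↦ hodgeConjectureFor_of_HC_CM_of_invariantCycles_through hCM hex A (hIC A hA)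

/-- **Cell `HodgeQuarticTypeIVFourfoldTimesCMSurface` (K3 partner), `HC_CM` LOAD-BEARING**: `HC_CM` + Deligne's
CM-anchored families + (1.1) on those through the members. [cite: Abdulali1994FamiliesAV, Lemma 6.2]
[cite: GeemenSchuett2010, §8] [cite: MoonenZarhin1999LowDim, §2 (2.3)] -/
theorem hodgeQuarticTypeIVFourfoldTimesCMSurface_of_HC_CM_of_invariantCycles_through
    (hCM : RankFourFaces.CMAbelianHodge) (hex : deligne1982_exists_cmAnchoredHodgeFamily)
    (hIC : ∀ A, Motiv.ProdCMCell IsQuarticFieldTypeIVFourfold (fun Z ↦ Z.dim = 2) A →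
      ∀ (p : ℕ) (c : complexBetti A.X (2 * p)) ⦃𝒳 S : SchemeOver ℂ⦄ (f : 𝒳 ⟶ S),
      IsCMAnchoredHodgeFamilyFor A p c f → InvariantCyclesHoldFor f A.dim) :
    HodgeQuarticTypeIVFourfoldTimesCMSurface :=
  hcOnClass_of_HC_CM_of_invariantCycles_through hCM hex hIC

/-- **Power cell `g = 6`, `HC_CM` LOAD-BEARING**: `HC_CM` + Deligne's CM-anchored families + (1.1) on those through
every power `(E × Y)ᴺ⁺¹`. [cite: Abdulali1994FamiliesAV, Lemma 6.2] [cite: MoonenZarhin1999LowDim, §3 (3.8)] -/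
theorem hodgePowersOfCMEllipticTimesUnitaryFivefold_of_HC_CM_of_invariantCycles_through
    (hCM : RankFourFaces.CMAbelianHodge) (hex : deligne1982_exists_cmAnchoredHodgeFamily)
    (hIC : ∀ (E Y : AbelianVariety ℂ) (φ : E ⟶ E) (ψ : Y ⟶ Y) (d : ℕ), 0 < d → E.dim = 1 → Y.dim = 5 →
      Y.IsSimple → φ ≫ φ = -(d • 𝟙 E) → ψ ≫ ψ = -(d • 𝟙 Y) → ∀ (N p : ℕ)
      (c : complexBetti ((E.prod Y).powSucc N).X (2 * p)) ⦃𝒳 S : SchemeOver ℂ⦄ (f : 𝒳 ⟶ S),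
      IsCMAnchoredHodgeFamilyFor ((E.prod Y).powSucc N) p c f → InvariantCyclesHoldFor f ((E.prod Y).powSucc N).dim) :
    HodgePowersOfCMEllipticTimesUnitaryFivefold :=
  fun E Y φ ψ d hd hE hY hs hφ hψ N ↦
    hodgeConjectureFor_of_HC_CM_of_invariantCycles_through hCM hex _ (hIC E Y φ ψ d hd hE hY hs hφ hψ N)

/-- **Power cell `g = 7`, `HC_CM` LOAD-BEARING** (same shape, `dim Y = 6`). [cite: Abdulali1994FamiliesAV, Lemma 6.2]
[cite: MoonenZarhin1999LowDim, §3 (3.1)] -/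
theorem hodgePowersOfCMEllipticTimesUnitarySixfold_of_HC_CM_of_invariantCycles_through
    (hCM : RankFourFaces.CMAbelianHodge) (hex : deligne1982_exists_cmAnchoredHodgeFamily)
    (hIC : ∀ (E Y : AbelianVariety ℂ) (φ : E ⟶ E) (ψ : Y ⟶ Y) (d : ℕ), 0 < d → E.dim = 1 → Y.dim = 6 →
      Y.IsSimple → φ ≫ φ = -(d • 𝟙 E) → ψ ≫ ψ = -(d • 𝟙 Y) → ∀ (N p : ℕ)
      (c : complexBetti ((E.prod Y).powSucc N).X (2 * p)) ⦃𝒳 S : SchemeOver ℂ⦄ (f : 𝒳 ⟶ S),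
      IsCMAnchoredHodgeFamilyFor ((E.prod Y).powSucc N) p c f → InvariantCyclesHoldFor f ((E.prod Y).powSucc N).dim) :
    HodgePowersOfCMEllipticTimesUnitarySixfold :=
  fun E Y φ ψ d hd hE hY hs hφ hψ N ↦
    hodgeConjectureFor_of_HC_CM_of_invariantCycles_through hCM hex _ (hIC E Y φ ψ d hd hE hY hs hφ hψ N)

/-- **Power cells, `HC_CM` DISCHARGED (row D8)**: the natural anchors of a family through `(E × Y)ᴺ⁺¹` are the
CM-ELLIPTIC POWERS `E'^{g(N+1)}` (specialise `Y`), where HC is Tate's theorem; (1.1) on such CM-power-anchored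
families through every power gives the `g = 6` cell with no `HC_CM`. [cite: vanGeemen1994HodgeAV, Thm. 4.3]
[cite: Abdulali1994FamiliesAV, (1.1) and Lemma 6.2] -/
theorem hodgePowersOfCMEllipticTimesUnitaryFivefold_of_invariantCycles_on_cmPowerAnchored_families
    (hfam : ∀ (E Y : AbelianVariety ℂ) (φ : E ⟶ E) (ψ : Y ⟶ Y) (d : ℕ), 0 < d → E.dim = 1 → Y.dim = 5 →
      Y.IsSimple → φ ≫ φ = -(d • 𝟙 E) → ψ ≫ ψ = -(d • 𝟙 Y) → ∀ (N p : ℕ)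
      (c : complexBetti ((E.prod Y).powSucc N).X (2 * p)), IsRationalClass c →
      IsOfHodgeType ((E.prod Y).powSucc N).dim ((E.prod Y).powSucc N).X (2 * p) p p c →
        ∃ (𝒳 S : SchemeOver ℂ) (f : 𝒳 ⟶ S) (s₁ : ComplexPoints S) (e : ((E.prod Y).powSucc N).X ≅ fiberOver f s₁)
          (W : complexBetti 𝒳 (2 * p)),
          (∀ t : ComplexPoints S, IsRationalClass (complexBetti.map (fiberι f t) (2 * p) W) ∧
            IsOfHodgeType ((E.prod Y).powSucc N).dim (fiberOver f t) (2 * p) p p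
              (complexBetti.map (fiberι f t) (2 * p) W)) ∧
          complexBetti.map e.hom (2 * p) (complexBetti.map (fiberι f s₁) (2 * p) W) = c ∧
          InvariantCyclesHoldFor f ((E.prod Y).powSucc N).dim ∧
          (cmPowerLocus f ((E.prod Y).powSucc N).dim).Nonempty) :
    HodgePowersOfCMEllipticTimesUnitaryFivefold :=
  fun E Y φ ψ d hd hE hY hs hφ hψ N ↦
    hodgeConjectureFor_of_invariantCycles_on_cmPowerAnchored_families_through _
      (hfam E Y φ ψ d hd hE hY hs hφ hψ N)

/-! ## §6 On path: every input of this file holds under the Hodge conjecture (nothing asserted) -/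

/-- **On path**: under `HC(A)` the Weil classes of every Weil structure of `A` are algebraic, so the Weil input
(W) of §2/§4 holds (`allWeilClasses A p ≤ Nᵖ`). ((G) is a statement about the SHAPE of the Hodge ring — which
classes exist — and is not a consequence of HC; it is the members' printed Hodge-ring computation.)
[cite: Deligne1982HodgeCycles, §4 Prop. 4.4] -/
theorem allWeilClasses_le_algebraicClasses_of_hodgeConjectureFor {A : AbelianVariety ℂ}
    (hHC : HodgeConjectureFor A.dim A.X) (p : ℕ) : allWeilClasses A p ≤ algebraicClasses A.X p :=
  allWeilClasses_le_algebraicClasses fun _ _ hW ↦ weilClasses_algebraic_of_hodgeConjectureFor hW hHC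

end Summit.HodgeConjecture.HodgeConjecture.Ring2.Hypotheses

end
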